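import Mathlib
import HarnessLib
import Summits.Ventures.LatticeQCDFlow.Exactness.NCMCGeneralSpaceTempered
import Summits.Ventures.LatticeQCDFlow.Exactness.NCMCGeneralSpaceSweepRestart
import Summits.Ventures.LatticeQCDFlow.Exactness.NCMCGeneralSpaceWilsonHeatBathBar

/-!
# The tempered-transitions lane is ergodic as soon as its level sampler is minorised: time averages along the round-trip chain estimate prior expectations almost surely

HONEST FRAMING: exact (Metropolis-corrected) sampling algorithms for lattice gauge theory;
figures of merit are autocorrelation/cost numbers at stated couplings and volumes; no
continuum-physics claim.

Venture `LatticeQCDFlow` (cell pub-lqcd), topic `Exactness`; FANOUT row 13 (`eng-snf`, GEN-17).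
NEW WORK of the cell, not a published result; no definition is introduced; nothing is cited as a
fact (Birkhoff's theorem enters as the tree-PROVED
`Literature.Dynamics.Ergodic.birkhoff_ergodic_theorem_of_ergodic_holds`; Neal 1996 "tempered
transitions" named only).  The third Metropolization of `latflow-snf` (`snf.tempered`, typed in
population by `NCMCGeneralSpaceTempered.temperedTransition_invariant`: the round trip of a Crooks pair
— up with the forward protocol, down with the reverse one, accept the final point with
`min(1, e^{−W_rt})` — leaves the level weight `ν₀` invariant) gets its SAMPLING statement here, in
the style of GEN-16/17: interleaved with a `ν₀`-invariant level sampler `T` minorised by a non-zero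
measure `m`, the iteration `ttKernel ∘ₖ T` is minorised by `ttKernel ∘ₘ m ≠ 0`
(`NCMCGeneralSpaceSweepRestart.measure_le_comp`), hence its chain started in `π₀ = Z₀⁻¹ ν₀` is ergodic
(`NCMCGeneralSpaceMarkovErgodicCriteria.ergodic_shift_chain_of_measure_le`) and time averages of
integrable observables converge almost surely.

## Content

* §1 (any Markov kernel `S` after a level sampler `T` minorised by a non-zero finite `m`, started in an
  invariant probability law `π`): `ergodic_chain_comp_of_measure_le`, `tendsto_sum_div_ae_chain_comp`
  — the general statement (one level: a common minorising measure survives ANY exact post-move; the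
  two-level NCMC switch needed `NCMCGeneralSpaceOccupancyChainErgodic.lean` instead).
* §2 **`CrooksPair.tendsto_sum_div_ae_temperedChain`** — for every Crooks pair between finite
  weights with `Z₀ ≠ 0`, every `ν₀`-invariant Markov `T` minorised by a non-zero finite measure, and
  every `φ ∈ L¹(π₀)`: along the chain of `ttKernel(round trip) ∘ₖ T` started in `π₀`,
  `(1/n) Σ_{i<n} φ(x_i) → ∫ φ dπ₀` almost surely.
* §3 **`CrooksPair.tendsto_sum_div_ae_wilsonHeatBathTempered`** — THE ENGINE INSTANCE: torus Wilson
  theory (`G` compact second countable with measurable points, `ρ` continuous, `L ≠ 0`),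
  level `ν₀ = wilsonWeight ρ β`,
  level sampler = the heat-bath link sweep over an edge list visiting every edge, ANY Crooks pair out
  of `wilsonWeight ρ β` for the round trip: time averages of every continuous observable converge to
  `⟨φ⟩_β` almost surely.

NOT CLAIMED: the pure tempered-transition chain WITHOUT a level sampler (not ergodic in general:
a deterministic protocol confines it to an orbit); rates; error bars (row 8's Doeblin files apply to
the minorised composite for BOUNDED observables — not restated here).
-/

namespace Summit.Ventures.LatticeQCDFlow.Exactness.GeneralNCMC

open MeasureTheory ProbabilityTheory Set Filter Finset
open scoped ENNReal Topology

variable {Ω : Type*} [MeasurableSpace Ω]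

/-! ## §1 An exact move after a minorised level sampler: ergodic -/

section Comp

variable (S T : Kernel Ω Ω) [IsMarkovKernel S] [IsMarkovKernel T] {π : Measure Ω}
  [IsProbabilityMeasure π]

/-- **Any exact move after a minorised level sampler gives an ergodic chain.**  `T` minorised by a
non-zero finite `m`, `S` any Markov kernel, `π` an invariant probability law of `S ∘ₖ T`: the chain
started in `π` is shift-ergodic (`S ∘ₖ T` is minorised by `S ∘ₘ m ≠ 0`). -/
theorem ergodic_chain_comp_of_measure_le (hπ : Kernel.Invariant (S ∘ₖ T) π) {m : Measure Ω}
    [IsFiniteMeasure m] (hm0 : m univ ≠ 0) (hmin : ∀ z, m ≤ T z) :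
    Ergodic (fun (x : ℕ → Ω) (k : ℕ) => x (k + 1))
      (Kernel.trajMeasure (X := fun _ : ℕ => Ω) π
        (fun n : ℕ => (S ∘ₖ T).comap (fun h : (j : ↥(Finset.Iic n)) → Ω =>
          h ⟨n, Finset.mem_Iic.2 le_rfl⟩) (measurable_pi_apply _))) := by
  haveI : IsFiniteMeasure (m.bind S) :=
    ⟨by rw [bind_apply_univ_of_markov S m]; exact measure_lt_top _ _⟩
  exact ergodic_shift_chain_of_measure_le _ hπ (m := m.bind S)
    (by rwa [bind_apply_univ_of_markov S m]) (measure_le_comp T S hmin)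

/-- Hence time averages of `π`-integrable observables converge almost surely along it. -/
theorem tendsto_sum_div_ae_chain_comp (hπ : Kernel.Invariant (S ∘ₖ T) π) {m : Measure Ω}
    [IsFiniteMeasure m] (hm0 : m univ ≠ 0) (hmin : ∀ z, m ≤ T z) {φ : Ω → ℝ} (hφ : Integrable φ π) :
    ∀ᵐ x ∂(Kernel.trajMeasure (X := fun _ : ℕ => Ω) π
        (fun n : ℕ => (S ∘ₖ T).comap (fun h : (j : ↥(Finset.Iic n)) → Ω =>
          h ⟨n, Finset.mem_Iic.2 le_rfl⟩) (measurable_pi_apply _))),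
      Tendsto (fun n : ℕ => (∑ i ∈ range n, φ (x i)) / n) atTop (𝓝 (∫ a, φ a ∂π)) :=
  tendsto_sum_div_ae_chain _ (ergodic_chain_comp_of_measure_le S T hπ hm0 hmin) hπ hφ

end Comp

/-! ## §2 Tempered transitions interleaved with a minorised level sampler -/

namespace CrooksPair

variable [MeasurableSingletonClass Ω] {E : Type*} [MeasurableSpace E]
variable {ν₀ ν₁ : Measure Ω} [IsFiniteMeasure ν₀] [IsFiniteMeasure ν₁] {κF κR : Kernel Ω E}
  [IsMarkovKernel κF] [IsMarkovKernel κR] {s e : E → Ω} {W : E → ℝ}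

/-- **THE TEMPERED-TRANSITIONS LANE IS CONSISTENT.**  For every Crooks pair between finite weights
(`Z₀ ≠ 0`), every `ν₀`-invariant Markov level sampler `T` minorised by a non-zero finite measure and
every `φ ∈ L¹(π₀)`, `π₀ = Z₀⁻¹ ν₀`: along the chain of "round trip (up with `κF`, down with `κR`,
accept the end point with `min(1, e^{−W_rt})`) after `T`" started in `π₀`, the time average of `φ`
converges to `∫ φ dπ₀` almost surely. -/
theorem tendsto_sum_div_ae_temperedChain (h : CrooksPair ν₀ ν₁ κF κR s e W) (h0 : ν₀ univ ≠ 0)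
    (T : Kernel Ω Ω) [IsMarkovKernel T] (hT : Kernel.Invariant T ν₀) {m : Measure Ω}
    [IsFiniteMeasure m] (hm0 : m univ ≠ 0) (hmin : ∀ z, m ≤ T z) {φ : Ω → ℝ}
    (hφ : Integrable φ ((ν₀ univ)⁻¹ • ν₀)) :
    haveI := isMarkovKernel_ttKernel (κ := compFwd κF κR e h.measurable_e)
      (show Measurable (fun ε : E × E => W ε.1 + -W ε.2) from
        (h.measurable_W.comp measurable_fst).add (h.measurable_W.comp measurable_snd).neg)
      (show Measurable (fun ε : E × E => s ε.2) from h.measurable_s.comp measurable_snd)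
    haveI : IsProbabilityMeasure ((ν₀ univ)⁻¹ • ν₀) :=
      ⟨by rw [Measure.smul_apply, smul_eq_mul, ENNReal.inv_mul_cancel h0 (measure_ne_top _ _)]⟩
    ∀ᵐ x ∂(Kernel.trajMeasure (X := fun _ : ℕ => Ω) ((ν₀ univ)⁻¹ • ν₀)
        (fun n : ℕ => ((ttKernel (compFwd κF κR e h.measurable_e) (fun ε => W ε.1 + -W ε.2)
            fun ε => s ε.2) ∘ₖ T).comap
          (fun hh : (j : ↥(Finset.Iic n)) → Ω => hh ⟨n, Finset.mem_Iic.2 le_rfl⟩)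
          (measurable_pi_apply _))),
      Tendsto (fun n : ℕ => (∑ i ∈ range n, φ (x i)) / n) atTop
        (𝓝 (∫ a, φ a ∂((ν₀ univ)⁻¹ • ν₀))) := by
  haveI := isMarkovKernel_ttKernel (κ := compFwd κF κR e h.measurable_e)
    (show Measurable (fun ε : E × E => W ε.1 + -W ε.2) from
      (h.measurable_W.comp measurable_fst).add (h.measurable_W.comp measurable_snd).neg)
    (show Measurable (fun ε : E × E => s ε.2) from h.measurable_s.comp measurable_snd)
  haveI : IsProbabilityMeasure ((ν₀ univ)⁻¹ • ν₀) :=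
    ⟨by rw [Measure.smul_apply, smul_eq_mul, ENNReal.inv_mul_cancel h0 (measure_ne_top _ _)]⟩
  have hinv : Kernel.Invariant ((ttKernel (compFwd κF κR e h.measurable_e)
      (fun ε => W ε.1 + -W ε.2) fun ε => s ε.2) ∘ₖ T) ((ν₀ univ)⁻¹ • ν₀) :=
    invariant_smul _ ((temperedTransition_invariant h).comp hT) _
  exact tendsto_sum_div_ae_chain_comp _ T hinv hm0 hmin hφ

end CrooksPair

/-! ## §3 The engine instance: torus Wilson theory, heat-bath link sweep between round trips -/

section Wilson

open Literature.MathematicalPhysics.QuantumFieldTheory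

variable {d L N : ℕ} {G : Type*} [Group G] [TopologicalSpace G] [IsTopologicalGroup G]
  (ρ : G →* Matrix (Fin N) (Fin N) ℂ) [CompactSpace G] [MeasurableSpace G] [BorelSpace G]
  [SecondCountableTopology G] [MeasurableSingletonClass G]

/-- **THE TEMPERED-TRANSITIONS ENGINE INSTANCE.**  Torus Wilson theory (`G` compact second countable,
`ρ` continuous, `L ≠ 0`), level weight `wilsonWeight ρ β`, level sampler = the single-link heat-bath
scan over an edge list visiting every edge; for EVERY Crooks pair out of `wilsonWeight ρ β` (to any
finite `ν₁`) driving the round trips and every CONTINUOUS observable `φ`: along the chain started in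
`π_β = Z_β⁻¹ · wilsonWeight ρ β` the time average of `φ` converges to `⟨φ⟩_β` almost surely. -/
theorem CrooksPair.tendsto_sum_div_ae_wilsonHeatBathTempered [NeZero L] (hρ : Continuous ρ) (β : ℝ)
    {l : List (Edge d L)} (hl : ∀ ed, ed ∈ l) {E : Type*} [MeasurableSpace E]
    {ν₁ : Measure (GaugeConfig d L G)} [IsFiniteMeasure ν₁]
    {κF κR : Kernel (GaugeConfig d L G) E} [IsMarkovKernel κF] [IsMarkovKernel κR]
    {s e : E → GaugeConfig d L G} {W : E → ℝ}
    (h : CrooksPair (wilsonWeight (d := d) (L := L) ρ β) ν₁ κF κR s e W)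
    {φ : GaugeConfig d L G → ℝ} (hφ : Continuous φ) :
    ∃ (_ : IsMarkovKernel (cycle (l.map (siteHeatBath (fun _ : Edge d L => haarProbability G)
        (gibbsDensity fun U : GaugeConfig d L G => β * wilsonAction ρ U)))))
      (_ : IsMarkovKernel (ttKernel (compFwd κF κR e h.measurable_e) (fun ε => W ε.1 + -W ε.2)
        fun ε => s ε.2))
      (_ : IsProbabilityMeasure (((wilsonWeight (d := d) (L := L) ρ β) univ)⁻¹ •
        wilsonWeight (d := d) (L := L) ρ β)),
      ∀ᵐ x ∂(Kernel.trajMeasure (X := fun _ : ℕ => GaugeConfig d L G)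
          (((wilsonWeight (d := d) (L := L) ρ β) univ)⁻¹ • wilsonWeight (d := d) (L := L) ρ β)
          (fun n : ℕ => ((ttKernel (compFwd κF κR e h.measurable_e) (fun ε => W ε.1 + -W ε.2)
              fun ε => s ε.2) ∘ₖ
            cycle (l.map (siteHeatBath (fun _ : Edge d L => haarProbability G)
              (gibbsDensity fun U : GaugeConfig d L G => β * wilsonAction ρ U)))).comap
            (fun hh : (j : ↥(Finset.Iic n)) → GaugeConfig d L G => hh ⟨n, Finset.mem_Iic.2 le_rfl⟩)
            (measurable_pi_apply _))),
        Tendsto (fun n : ℕ => (∑ i ∈ range n, φ (x i)) / n) atTop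
          (𝓝 (∫ U, φ U ∂(((wilsonWeight (d := d) (L := L) ρ β) univ)⁻¹ •
            wilsonWeight (d := d) (L := L) ρ β))) := by
  obtain ⟨hMk, hfin, m, hmfin, h0, hm0, hK, hmin⟩ := wilson_heatBathSweep_package ρ hρ β hl
  haveI := hMk
  haveI := hfin
  haveI := hmfin
  haveI hP : IsProbabilityMeasure (((wilsonWeight (d := d) (L := L) ρ β) univ)⁻¹ •
      wilsonWeight (d := d) (L := L) ρ β) :=
    ⟨by rw [Measure.smul_apply, smul_eq_mul, ENNReal.inv_mul_cancel h0 (measure_ne_top _ _)]⟩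
  -- a continuous observable of the compact gauge field is bounded, hence integrable
  haveI : Nonempty (GaugeConfig d L G) := ⟨fun _ => 1⟩
  obtain ⟨ωb, -, hmax⟩ := isCompact_univ.exists_isMaxOn Set.univ_nonempty hφ.norm.continuousOn
  have hφi : Integrable φ (((wilsonWeight (d := d) (L := L) ρ β) univ)⁻¹ •
      wilsonWeight (d := d) (L := L) ρ β) :=
    Integrable.of_bound hφ.measurable.aestronglyMeasurable ‖φ ωb‖
      (Eventually.of_forall fun U => (isMaxOn_iff.1 hmax) U (Set.mem_univ U))
  exact ⟨hMk, isMarkovKernel_ttKernel (κ := compFwd κF κR e h.measurable_e)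
      (show Measurable (fun ε : E × E => W ε.1 + -W ε.2) from
        (h.measurable_W.comp measurable_fst).add (h.measurable_W.comp measurable_snd).neg)
      (show Measurable (fun ε : E × E => s ε.2) from h.measurable_s.comp measurable_snd), hP,
    h.tendsto_sum_div_ae_temperedChain h0 _ hK hm0 hmin hφi⟩

end Wilson

end Summit.Ventures.LatticeQCDFlow.Exactness.GeneralNCMC
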